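import Summits.RiemannHypothesis.RiemannHypothesis.Theorems.PfPersistenceMarkovCoreWindowFeynmanHellmann
import HarnessLib

/-!
# PF persistence (theory 1, edge law): THE MARKOV CORE, XVII — STRICT window monotonicity of the
# core bottom between entering windows; the arch-only bottom is strictly positive, strictly
# decreasing, and its window response is negative on a dense set of windows

Helper file (`--supports stmt-RiemannHypothesis-19953`); mechanism/rigidity campaign; no RH claims.
Companion text `run/shared/lean/pub/pub-rhpf/pub-rhpf-theory-1/THEORY-EDGE-8.md`.

File XVI proved `HasDerivAt archBottom (archWindowResponse a / a) a` at every window with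
`archWindowResponse a ≤ 0`.  Here the POSITIVITY of core ground states (file IV,
`IsCoreGround.ae_pos`: `|Φ| > 0` a.e. on the open window) is turned into STRICTNESS in the window:

* `tableDirichletEnergy_eq_of_uncharged`: if no integer entering between the windows `a ≤ b` is
  charged by the table (`w n = 0` for `n ∈ weilPrimeIndex b \ weilPrimeIndex a`), the table energies
  of the two windows agree on every function;
* `coreBottom_lt_of_uncharged` (**STRICT WINDOW MONOTONICITY**): for a table `w ≥ 0` on the index
  and windows `0 < a < b` with no charged entering integer, `coreBottom w b < coreBottom w a` — a
  ground state of the window `a` vanishes on `(a, b)`, so it cannot be a ground state of the window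
  `b`, whose ground states are a.e. non-zero on `(-b, b)`;
* `archBottom_lt` / `strictAntiOn_archBottom`: the arch-only bottom is STRICTLY decreasing on
  `(0, ∞)`; `archBottom_pos`: it is STRICTLY positive at every window;
* `exists_archWindowResponse_neg` / `frequently_archWindowResponse_neg`: by the mean value
  theorem the window response `∫ (tρ)′ D(Φ_c)` is NEGATIVE at some window of every interval
  `(a, b)`, hence frequently to the right of every window (negativity at EVERY window is not
  claimed: it is the open trace identity of THEORY-EDGE-8 §4, R1″).

All statements hold for every table of the class alike (structure, not an invariant); RH-free,
arithmetic-free.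

References: Reed–Simon IV §XIII.12 (positivity of ground states ⇒ strict monotonicity under
domain enlargement); Bombieri 2000 Thm 5 (window monotonicity); Kato 1966 VII §4.
-/

set_option linter.dupNamespace false

noncomputable section

open MeasureTheory Set Filter Metric
open scoped Topology

namespace Summit.RiemannHypothesis.RiemannHypothesis.Theorems.PfPersistence

open Literature.NumberTheory.LFunctions

variable {a b : ℝ}

/-! ## §1 Windows without charged entering integers: equal energies, strict monotonicity -/

/-- The prime index grows with the window. [folklore] -/
theorem weilPrimeIndex_mono (hab : a ≤ b) : weilPrimeIndex a ⊆ weilPrimeIndex b := by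
  intro n hn
  rw [mem_weilPrimeIndex] at hn ⊢
  linarith

/-- If no integer entering between the windows `a ≤ b` is charged, the table energies of the two
windows agree. [folklore] -/
theorem tableDirichletEnergy_eq_of_uncharged {w : ℕ → ℝ} (hab : a ≤ b)
    (hI : ∀ n ∈ weilPrimeIndex b, n ∉ weilPrimeIndex a → w n = 0) (f : ℝ → ℂ) :
    tableDirichletEnergy b w f = tableDirichletEnergy a w f := by
  unfold tableDirichletEnergy
  rw [Finset.sum_subset (weilPrimeIndex_mono hab) fun n hnb hna ↦ by rw [hI n hnb hna, zero_mul]]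

/-- The finite-energy class grows with the window. [folklore] -/
theorem coreAdm_mono {f : ℝ → ℂ} (hf : coreAdm a f) (hab : a ≤ b) : coreAdm b f :=
  ⟨hf.1, fun x hx ↦ hf.2.1 x fun h ↦ hx (Icc_subset_Icc (by linarith) hab h), hf.2.2⟩

/-- Window monotonicity of the core bottom between windows without charged entering integers.
[cite: Bombieri2000Weil, Thm 5] -/
theorem coreBottom_le_of_uncharged {w : ℕ → ℝ} (hw : ∀ n ∈ weilPrimeIndex b, 0 ≤ w n)
    (ha : 0 < a) (hab : a ≤ b) (hI : ∀ n ∈ weilPrimeIndex b, n ∉ weilPrimeIndex a → w n = 0) :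
    coreBottom w b ≤ coreBottom w a := by
  refine le_csInf (coreSet_nonempty w ha) ?_
  rintro _ ⟨f, hf, hn, rfl⟩
  rw [← tableDirichletEnergy_eq_of_uncharged hab hI f]
  exact coreBottom_le hw (coreAdm_mono hf hab) hn

/-- A function of the class of the window `a > 0` that is a.e. non-zero on the open window
`b > a` does not exist: it vanishes on `(a, b)`, a set of positive measure. [folklore] -/
theorem not_ae_pos_of_coreAdm {f : ℝ → ℂ} (hf : coreAdm a f) (ha : 0 < a) (hab : a < b)
    (h : ∀ᵐ x : ℝ, x ∈ Ioo (-b) b → 0 < ‖f x‖) : False := by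
  have h0 : ∀ᵐ x : ℝ, x ∉ Ioo a b := by
    filter_upwards [h] with x hx hxab
    have hfx : f x = 0 := hf.2.1 x fun hI ↦ by linarith [hI.2, hxab.1]
    have hxa : -b < x := by linarith [hxab.1, hxab.2]
    have := hx ⟨hxa, hxab.2⟩
    rw [hfx, norm_zero] at this
    exact lt_irrefl _ this
  have hμ : volume (Ioo a b) = 0 := measure_eq_zero_iff_ae_notMem.2 h0
  rw [Real.volume_Ioo, ENNReal.ofReal_eq_zero] at hμ
  linarith

/-- **STRICT WINDOW MONOTONICITY OF THE CORE BOTTOM** between windows without charged entering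
integers: for a table `w ≥ 0` on the index and `0 < a < b` with `w n = 0` for every entering
`n ∈ weilPrimeIndex b \ weilPrimeIndex a`, `coreBottom w b < coreBottom w a`.  A ground state of
the window `a` (file VII) would otherwise be a ground state of the window `b` vanishing on `(a, b)`,
against the positivity of core ground states (file IV, `IsCoreGround.ae_pos`).
[cite: ReedSimonIV1978, §XIII.12 Thm XIII.44] -/
theorem coreBottom_lt_of_uncharged {w : ℕ → ℝ} (hw : ∀ n ∈ weilPrimeIndex b, 0 ≤ w n)
    (ha : 0 < a) (hab : a < b) (hI : ∀ n ∈ weilPrimeIndex b, n ∉ weilPrimeIndex a → w n = 0) :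
    coreBottom w b < coreBottom w a := by
  have hb : 0 < b := ha.trans hab
  have hwa : ∀ n ∈ weilPrimeIndex a, 0 ≤ w n := fun n hn ↦ hw n (weilPrimeIndex_mono hab.le hn)
  obtain ⟨u, hu⟩ := exists_isCoreGround hwa ha
  refine (coreBottom_le_of_uncharged hw ha hab.le hI).lt_of_ne fun hEq ↦ ?_
  have hub : IsCoreGround w b u := by
    refine ⟨coreAdm_mono hu.1 hab.le, hu.2.1, ?_⟩
    rw [tableDirichletEnergy_eq_of_uncharged hab.le hI, hu.2.2, hEq]
  exact not_ae_pos_of_coreAdm hu.1 ha hab (hub.ae_pos hw hb)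

/-! ## §2 The arch-only core: strictly decreasing, strictly positive -/

/-- **The arch-only bottom is STRICTLY decreasing in the window**: `archBottom b < archBottom a`
for `0 < a < b`. [cite: ReedSimonIV1978, §XIII.12 Thm XIII.44] -/
theorem archBottom_lt (ha : 0 < a) (hab : a < b) : archBottom b < archBottom a :=
  coreBottom_lt_of_uncharged (fun _ _ ↦ le_rfl) ha hab fun _ _ _ ↦ rfl

/-- `archBottom` is strictly antitone on `(0, ∞)`. [cite: ReedSimonIV1978, §XIII.12 Thm XIII.44] -/
theorem strictAntiOn_archBottom : StrictAntiOn archBottom (Ioi 0) :=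
  fun _ ha _ _ hab ↦ archBottom_lt ha hab

/-- **The arch-only bottom is STRICTLY POSITIVE at every window** (it is non-negative at the
window `a + 1` and strictly larger at `a`). [cite: ReedSimonIV1978, §XIII.12 Thm XIII.44] -/
theorem archBottom_pos (ha : 0 < a) : 0 < archBottom a :=
  (archBottom_nonneg (by linarith : (0 : ℝ) < a + 1)).trans_lt (archBottom_lt ha (by linarith))

/-- Every core bottom of a table non-negative on the index is strictly positive (the arch-only
bottom is the floor of the class, file IX). [cite: ReedSimonIV1978, §XIII.12 Thm XIII.44] -/
theorem coreBottom_pos {w : ℕ → ℝ} (hw : ∀ n ∈ weilPrimeIndex a, 0 ≤ w n) (ha : 0 < a) :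
    0 < coreBottom w a :=
  (archBottom_pos ha).trans_le (coreBottom_archOnly_le hw ha)

/-! ## §3 The window response is negative on a dense set of windows -/

/-- `deriv archBottom a = archWindowResponse a / a` (file XVI). [cite: Kato1966, VII §4] -/
theorem deriv_archBottom (ha : 0 < a) : deriv archBottom a = archWindowResponse a / a :=
  (hasDerivAt_archBottom ha).deriv

/-- **Mean value form of strictness**: every window interval `(a, b)`, `0 < a < b`, contains a
window `c` with NEGATIVE response `∫ (tρ)′(s) D_s(Φ_c) ds < 0` (equivalently `ε′(c) < 0`).
[cite: Kato1966, VII §4] -/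
theorem exists_archWindowResponse_neg (ha : 0 < a) (hab : a < b) :
    ∃ c ∈ Ioo a b, archWindowResponse c < 0 := by
  obtain ⟨c, hc, hcd⟩ := exists_hasDerivAt_eq_slope archBottom (fun c ↦ archWindowResponse c / c)
    hab (continuousOn_archBottom.mono fun x hx ↦ ha.trans_le hx.1)
    fun x hx ↦ hasDerivAt_archBottom (ha.trans hx.1)
  have hc0 : 0 < c := ha.trans hc.1
  have hneg : archWindowResponse c / c < 0 := by
    rw [hcd]
    exact div_neg_of_neg_of_pos (sub_neg.2 (archBottom_lt ha hab)) (sub_pos.2 hab)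
  refine ⟨c, hc, ?_⟩
  rcases div_neg_iff.1 hneg with h | h
  · exact absurd h.2 (not_lt.2 hc0.le)
  · exact h.1

/-- The response is negative FREQUENTLY to the right of every window. [cite: Kato1966, VII §4] -/
theorem frequently_archWindowResponse_neg (ha : 0 < a) :
    ∃ᶠ b in 𝓝[>] a, archWindowResponse b < 0 := by
  rw [(nhdsGT_basis a).frequently_iff]
  intro b hab
  obtain ⟨c, hc, hcn⟩ := exists_archWindowResponse_neg ha hab
  exact ⟨c, hc, hcn⟩

/-- The derivative of the arch-only bottom is negative frequently to the right of every window
(and `≤ 0` everywhere, file XVI). [cite: Kato1966, VII §4] -/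
theorem frequently_deriv_archBottom_neg (ha : 0 < a) : ∃ᶠ b in 𝓝[>] a, deriv archBottom b < 0 := by
  have hpos : ∀ᶠ b in 𝓝[>] a, 0 < b :=
    mem_nhdsWithin_of_mem_nhds ((isOpen_Ioi.mem_nhds ha))
  refine ((frequently_archWindowResponse_neg ha).and_eventually hpos).mono fun b hb ↦ ?_
  rw [deriv_archBottom hb.2]
  exact div_neg_of_neg_of_pos hb.1 hb.2

end Summit.RiemannHypothesis.RiemannHypothesis.Theorems.PfPersistence

end
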